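import Literature.NumberTheory.Automorphic.UnitaryGroupLocalCongr
import Literature.NumberTheory.Automorphic.UnitaryGroupHeckePlaceFactor
import HarnessLib

/-!
# The local congruence at a split place: `e_w ∘ κ_v ∘ e_w⁻¹ = conj(B_w)` and the invariance of `[U(𝒪_v) t U(𝒪_v)]`

Topic `NumberTheory/Automorphic`; namespace `Literature.NumberTheory.Automorphic.UnitaryGroup`.  Sequel (proof lane, theorems only) to
★ «D5» `UnitaryGroupLocalCongr` (`localCongr … v : U(J')(F_v) ≃ₜ* U(J)(F_v)`, `u ↦ B_v u B_v⁻¹`).  At a place `w ∣ v` SPLIT in `E/F` the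
split frames `e_w : U(J)(F_v) ≃ GL_N(E_w)` (★ `localPiSplitEquiv`, the `w`-projection) carry `κ_v` to conjugation by `B_w ∈ GL_N(E_w)`;
hence, where `B_w ∈ GL_N(𝒪_w)` and `J` has good reduction at `w`, pulling a representation `σ` of `U(J)(F_v)` back along `κ_v` does not
change the double coset operators of the elements `e_w⁻¹(t)` on `U(𝒪_v)`-fixed vectors (★ `heckeOperator_comp_mulEquiv_apply` + ★
`heckeOperator_mul_mul_eq`) — the «T2» socket of the cell `hodgecm-mathlib`'s d6 S4 assembly (A-p05 (g11) census
`CENSUS-D6-S4-final-assembly`): the LOCAL eigen-equation for `ρ_v ∘ κ_v` at `e_w'⁻¹(diag ϖ^{(i)})` is the one for `ρ_v` at `e_w⁻¹(diag ϖ^{(i)})`.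
Platonov–Rapinchuk §2.3/§5.1; Cartier §IV.1.  No named fact, no `sorry`; nothing of [Liu2021] is asserted.

## References
* V. Platonov, A. Rapinchuk, *Algebraic Groups and Number Theory* (1994), §2.3, §5.1 [PlatonovRapinchuk1994].
* P. Cartier, Corvallis 1979, part 1, §IV.1 [CartierCorvallis1979].
-/

noncomputable section

open MulAction NumberField IsDedekindDomain Filter Set
open scoped Matrix MatrixGroups

namespace Literature.NumberTheory.Automorphic

namespace UnitaryGroup

variable {F E : Type} [Field F] [NumberField F] [Field E] [NumberField E] [Algebra F E] [Algebra.IsQuadraticExtension F E]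
  {c : E ≃ₐ[F] E} {N : ℕ} (B : GL (Fin N) E) {a : E} (ha : a ≠ 0) {J J' : Matrix (Fin N) (Fin N) E}
  (h : formCongr (c : E →+* E) B (a • J) = J') {v : HeightOneSpectrum (𝓞 F)} (w : PlacesOver E v) (hc : c ≠ 1)
  (hJ : (J.map c)ᵀ = J) (hJ' : (J'.map c)ᵀ = J') (hw : c • w.1 ≠ w.1) (hJw : IsUnit (placeForm J w.1))
  (hJw' : IsUnit (placeForm J' w.1))

/-- **`e_w (κ_v u) = B_w · e_w' (u) · B_w⁻¹`**: in the split frames, the local congruence is conjugation by `B_w ∈ GL_N(E_w)`.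
[cite: PlatonovRapinchuk1994, §2.3] -/
theorem localPiSplitEquiv_localCongr_apply (u : localPi E c N J' v) :
    localPiSplitEquiv c J hc hJ w hw hJw (localCongr E c B ha h v u) =
      Matrix.GeneralLinearGroup.map (algebraMap E (w.1.adicCompletion E)) B * localPiSplitEquiv c J' hc hJ' w hw hJw' u *
        (Matrix.GeneralLinearGroup.map (algebraMap E (w.1.adicCompletion E)) B)⁻¹ := by
  rw [localPiSplitEquiv_apply, localPiSplitEquiv_apply, coe_localCongr_apply_apply]

/-- **`κ_v (e_w'⁻¹ g) = e_w⁻¹ (B_w g B_w⁻¹)`** (the same identity read through the inverse frames). [cite: PlatonovRapinchuk1994, §2.3] -/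
theorem localCongr_localPiSplitEquiv_symm_apply (g : GL (Fin N) (w.1.adicCompletion E)) :
    localCongr E c B ha h v ((localPiSplitEquiv c J' hc hJ' w hw hJw').symm g) =
      (localPiSplitEquiv c J hc hJ w hw hJw).symm
        (Matrix.GeneralLinearGroup.map (algebraMap E (w.1.adicCompletion E)) B * g *
          (Matrix.GeneralLinearGroup.map (algebraMap E (w.1.adicCompletion E)) B)⁻¹) := by
  apply (localPiSplitEquiv c J hc hJ w hw hJw).injective
  rw [localPiSplitEquiv_localCongr_apply B ha h w hc hJ hJ' hw hJw hJw', ContinuousMulEquiv.apply_symm_apply,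
    ContinuousMulEquiv.apply_symm_apply]

/-- At a place of good reduction for `J` where `B_w ∈ GL_N(𝒪_w)`: `κ_v (e_w'⁻¹ g) = k · e_w⁻¹(g) · k⁻¹` with `k := e_w⁻¹(B_w) ∈ U(J)(𝒪_v)`.
[cite: PlatonovRapinchuk1994, §5.1] -/
theorem localCongr_localPiSplitEquiv_symm_apply_eq_conj (hJi : hJw.unit ∈ glInt N (w.1.adicCompletion E))
    (hBw : Matrix.GeneralLinearGroup.map (algebraMap E (w.1.adicCompletion E)) B ∈ glInt N (w.1.adicCompletion E))
    (g : GL (Fin N) (w.1.adicCompletion E)) :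
    ∃ k ∈ localInt E c N J v,
      localCongr E c B ha h v ((localPiSplitEquiv c J' hc hJ' w hw hJw').symm g) =
        k * (localPiSplitEquiv c J hc hJ w hw hJw).symm g * k⁻¹ := by
  refine ⟨(localPiSplitEquiv c J hc hJ w hw hJw).symm (Matrix.GeneralLinearGroup.map (algebraMap E (w.1.adicCompletion E)) B),
    (localPiSplitEquiv_symm_mem_localInt_iff c J hc hJ w hw hJw hJi _).2 hBw, ?_⟩
  rw [localCongr_localPiSplitEquiv_symm_apply B ha h w hc hJ hJ' hw hJw hJw', map_mul, map_mul, map_inv]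

/-- **«T2»: pulling back along `κ_v` does not change the double coset operators of the split-frame elements.**  For a representation `σ`
of `U(J)(F_v)`, a place `v` where `κ_v` matches the integral levels (`κ_v u ∈ U(J)(𝒪_v) ↔ u ∈ U(J')(𝒪_v)` — a.e. `v`, ★
`eventually_localCongr_mem_localInt_iff`), `B_w ∈ GL_N(𝒪_w)`, `J` of good reduction at the split place `w`, and `y ∈ σ^{U(J)(𝒪_v)}`:
`[U(J')(𝒪_v) e_w'⁻¹(g) U(J')(𝒪_v)]_{σ ∘ κ_v} y = [U(J)(𝒪_v) e_w⁻¹(g) U(J)(𝒪_v)]_σ y` (★ `heckeOperator_comp_mulEquiv_apply`, then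
`[K k t k⁻¹ K] = [K t K]`, ★ `heckeOperator_mul_mul_eq`).  So a local eigen-equation for `σ` at `e_w⁻¹(diag ϖ^{(i)})` IS one for `σ ∘ κ_v`
at `e_w'⁻¹(diag ϖ^{(i)})` — the `hloc` input of ★ `IsHyperspecialAt.heckeTAt_apply_eq_smul` transports along the congruence.
[cite: CartierCorvallis1979, §IV.1] [cite: PlatonovRapinchuk1994, §5.1] -/
theorem heckeOperator_comp_localCongr_localPiSplitEquiv_symm_apply {k V : Type*} [CommRing k] [AddCommGroup V] [Module k V]
    (σ : Representation k (localPi E c N J v) V)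
    (hKv : ∀ u : localPi E c N J' v, localCongr E c B ha h v u ∈ localInt E c N J v ↔ u ∈ localInt E c N J' v)
    (hJi : hJw.unit ∈ glInt N (w.1.adicCompletion E))
    (hBw : Matrix.GeneralLinearGroup.map (algebraMap E (w.1.adicCompletion E)) B ∈ glInt N (w.1.adicCompletion E))
    (g : GL (Fin N) (w.1.adicCompletion E)) {y : V} (hy : y ∈ σ.fixedPoints (localInt E c N J v)) :
    heckeOperator (σ.comp (localCongr E c B ha h v).toMulEquiv.toMonoidHom) (localInt E c N J' v)
        ((localPiSplitEquiv c J' hc hJ' w hw hJw').symm g) y =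
      heckeOperator σ (localInt E c N J v) ((localPiSplitEquiv c J hc hJ w hw hJw).symm g) y := by
  rw [heckeOperator_comp_mulEquiv_apply σ (localCongr E c B ha h v).toMulEquiv (localInt E c N J' v) (localInt E c N J v)
    hKv _ (finite_orbit_localInt v _) hy]
  obtain ⟨κ₁, hκ₁, hconj⟩ := localCongr_localPiSplitEquiv_symm_apply_eq_conj B ha h w hc hJ hJ' hw hJw hJw' hJi hBw g
  change heckeOperator σ (localInt E c N J v) (localCongr E c B ha h v ((localPiSplitEquiv c J' hc hJ' w hw hJw').symm g)) y = _
  rw [hconj, heckeOperator_mul_mul_eq σ (localInt E c N J v) hκ₁ (Subgroup.inv_mem _ hκ₁)]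

/-- The eigen-form of «T2»: if `[U(J)(𝒪_v) e_w⁻¹(g) U(J)(𝒪_v)]` acts on `σ^{U(J)(𝒪_v)}` by `c₀`, then `[U(J')(𝒪_v) e_w'⁻¹(g) U(J')(𝒪_v)]` acts on
`(σ ∘ κ_v)^{U(J')(𝒪_v)}` by `c₀` (same place conditions). [cite: CartierCorvallis1979, §IV.1] [cite: PlatonovRapinchuk1994, §5.1] -/
theorem heckeOperator_comp_localCongr_apply_eq_smul {k V : Type*} [CommRing k] [AddCommGroup V] [Module k V]
    (σ : Representation k (localPi E c N J v) V)
    (hKv : ∀ u : localPi E c N J' v, localCongr E c B ha h v u ∈ localInt E c N J v ↔ u ∈ localInt E c N J' v)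
    (hJi : hJw.unit ∈ glInt N (w.1.adicCompletion E))
    (hBw : Matrix.GeneralLinearGroup.map (algebraMap E (w.1.adicCompletion E)) B ∈ glInt N (w.1.adicCompletion E))
    (g : GL (Fin N) (w.1.adicCompletion E)) (c₀ : k)
    (hloc : ∀ y ∈ σ.fixedPoints (localInt E c N J v),
      heckeOperator σ (localInt E c N J v) ((localPiSplitEquiv c J hc hJ w hw hJw).symm g) y = c₀ • y)
    {y : V} (hy : y ∈ Representation.fixedPoints (σ.comp (localCongr E c B ha h v).toMulEquiv.toMonoidHom) (localInt E c N J' v)) :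
    heckeOperator (σ.comp (localCongr E c B ha h v).toMulEquiv.toMonoidHom) (localInt E c N J' v)
        ((localPiSplitEquiv c J' hc hJ' w hw hJw').symm g) y = c₀ • y := by
  have hy' : y ∈ σ.fixedPoints (localInt E c N J v) := by
    rw [Representation.mem_fixedPoints] at hy ⊢
    intro u hu
    have := hy ((localCongr E c B ha h v).symm u) ((hKv _).1 (by rwa [ContinuousMulEquiv.apply_symm_apply]))
    rw [MonoidHom.coe_comp, Function.comp_apply, MulEquiv.coe_toMonoidHom] at this
    change (σ ((localCongr E c B ha h v) ((localCongr E c B ha h v).symm u))) y = y at this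
    rwa [ContinuousMulEquiv.apply_symm_apply] at this
  rw [heckeOperator_comp_localCongr_localPiSplitEquiv_symm_apply B ha h w hc hJ hJ' hw hJw hJw' σ hKv hJi hBw g hy']
  exact hloc y hy'

end UnitaryGroup

end Literature.NumberTheory.Automorphic

end
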